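import Summits.AtomisticToContinuum.FouriersLaw.Theses.BondHeatUncertainty

/-!
# Line `contact-kolmogorov-triad` — crux `BondHeatUncertainty.SubdiffusiveBondHeat` (stmt-AtomisticToContinuum-9120)

Skeleton (crux-plan, round 1) of the crux idea card `contact-kolmogorov-triad` (ideator 1, triage r1-1:
pass), planned TOGETHER with its companion card `bath-bond-deficit-integral` (card A) as the triage note
recommends: (S) is attacked at the bath bond `b = 0` (the crux lets the prover choose the bond), where

  (S)|_{b=0}  ⇐ [card A: bath-heat identity + statics]  DeficitUpperTail  ⇐ [card C: (T′) + C⁺₁ ∧ C⁺₂ ∧ C⁺₃].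

Objects (all at KERNEL level over the constructed `OscillatorChain.transitionKernel` / `gibbsMeasure` of
`P = pinnedChain ω₂ lam β γ`, both baths at `T`; no path space appears in any statement):
`θ₀ = p₀² − T` (`contactObs`), `P_sθ₀` (`memProp`), the replica memory `m_N(s)² = ‖P_sθ₀‖²_{L²(μ_T)}`
(`memNormSq`), the expected injected heat `u_t = E_z[Q^L_t] = −γ∫₀ᵗ P_rθ₀ dr` (`heatPotential`), the return
deficit `R_N(t) = ‖p₀ + ∂_{p₀}u_t‖²` (`returnDeficit`), the leak `L_N(t) = ‖∂_{p_{N−1}}u_t‖²` (`leak`), the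
boundary kernel `K_N(u) = ⟨θ₀, P_uθ₀⟩` (`memKernel`, VERBATIM the `K` of route `BoundaryEscapeDeficit` and of
card A) and the escape-deficit curve `1 − θ_N(t) = 1 − (γ/T²)∫₀ᵗ K_N` (`deficit`); the crux's own
`C_N(b,s)`, `V_N(b,t)` (`bondCorr`, `bondHeatVar`, verbatim) and the site-0 energy
`e₀ = p₀²/2 + U(q₀) + ½V(q₁−q₀)` (`siteZeroEnergy`; `L e₀ = −j₀ − γθ₀`).

Registered stubs (sorried; 6):
* `stub_boundaryMemoryDecay` — C⁺₁, the LOAD-BEARING N-uniform estimate, stated along the dyadic times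
  `s = 2^k ∈ [1, cN²]` (triage sharpening; equivalent to the pointwise form by the monotonicity in
  `stub_contactSemigroupCalculus`): `m_N(2^k)² ≤ C (2^k)^{−3/2}`.
* `stub_returnDeficitDecay` — C⁺₂: `R_N(s) ≤ C/√s` on `[1, cN²]`, uniformly in `N`.
* `stub_leakDecay` — C⁺₃: `L_N(s) ≤ C/√s` on `[1, cN²]`, uniformly in `N`.
* `stub_contactSemigroupCalculus` — FIXED N ≥ 2, the exact martingale/dissipation identity
  (T′) `1 − θ_N(t) = (γ/T²)∫₀ᵗ⟨P_rθ₀,P_tθ₀⟩dr + (R_N(t) + L_N(t))/T` in its Cauchy–Schwarz form, plus the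
  `L²(μ_T)`-contraction facts of the constructed semigroup (`s ↦ m_N(s)²` non-increasing, `m_N(0)² ≤ 2T²`,
  `|K_N| ≤ 2T²`).  Derivation recorded below: (T′) ⟺ `θ_N(t) = −⟨p₀, ∂_{p₀}u_t⟩_{μ_T}/T`, which is Gaussian
  integration by parts in `p₀` — no path space is needed.
* `stub_bathHeatDeficitFormula` — FIXED N ≥ 2 (card A's identity `d/dt Var_eq(Q^L_t) = 2γT²(1 − θ_N(t))`
  + energy balance at site 0 + Cauchy–Schwarz): `V_N(0,t) ≤ 4γT² ∫₀ᵗ (1 − θ_N) + 8 Var_{μ_T}(e₀)`.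
* `stub_localEnergyVariance` — statics: `sup_{N ≥ 2} Var_{μ_T^N}(e₀) < ∞`.

Composition (sorry-free, this file): `dyadic_to_pointwise`, `sqrt_bound`, `memory_integral_bound`,
`deficit_integral_bound` (real analysis), `deficitUpperTail_of_triad` (the Minkowski step of the card:
(T′) + C⁺₁..₃ ⇒ `1 − θ_N(s) ≤ C′/√s` on `[1, cN²]`), `bathBondEW_of_deficit` (card A's shape:
`∫₀ᵗ(1−θ_N) ≤ (1+2γ) + 2C′√t` ⇒ `V_N(0,t) ≤ A√t`), and `SubdiffusiveBondHeat_of : SubdiffusiveBondHeat`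
(take `b := 0`).

Disproof.lean: none exists for this crux at planning time (nothing to honour / import). Negatives index:
the only FouriersLaw negative (`DiluteCellGaussianiser.FarFieldGaussianity`) concerns other objects.
-/

noncomputable section

open MeasureTheory Set Filter Topology

namespace Summit.AtomisticToContinuum.FouriersLaw.Cruxes.SubdiffusiveBondHeat.ContactKolmogorovTriad

open Literature.MathematicalPhysics.KineticTheory.HeatConduction
open Summit.AtomisticToContinuum.FouriersLaw.Theses.BondHeatUncertainty (SubdiffusiveBondHeat)

/-! ## Objects (kernel level) -/

/-- The contact observable `θ₀(z) = p₀² − T` (`0` on the empty chain). -/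
def contactObs (T : ℝ) (N : ℕ) (z : PhaseSpace N) : ℝ :=
  if h : 0 < N then (z.2 ⟨0, h⟩) ^ 2 - T else 0

/-- The propagated contact observable `(P_s θ₀)(z) = ∫ θ₀ dκ_s(z, ·)`, `κ_s` the constructed transition
kernel of `pinnedChain ω₂ lam β γ` with both baths at `T`. -/
def memProp (ω₂ lam β γ T : ℝ) (N : ℕ) (s : ℝ) (z : PhaseSpace N) : ℝ :=
  ∫ y, contactObs T N y ∂((pinnedChain ω₂ lam β γ).transitionKernel N T T s.toNNReal z)

/-- The REPLICA MEMORY `m_N(s)² = ‖P_s θ₀‖²_{L²(μ_T)} = E[θ₀(z_s⁽¹⁾) θ₀(z_s⁽²⁾)]` (two copies from one Gibbs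
sample with independent bath noises). -/
def memNormSq (ω₂ lam β γ T : ℝ) (N : ℕ) (s : ℝ) : ℝ :=
  ∫ z, (memProp ω₂ lam β γ T N s z) ^ 2 ∂((pinnedChain ω₂ lam β γ).gibbsMeasure N T)

/-- The expected injected heat `u_t(z) = E_z[Q^L_t] = −γ ∫₀ᵗ (P_r θ₀)(z) dr` (solves the backward
Kolmogorov equation `∂_t u = L u − γθ₀`, `u_0 = 0`). -/
def heatPotential (ω₂ lam β γ T : ℝ) (N : ℕ) (t : ℝ) (z : PhaseSpace N) : ℝ :=
  -γ * ∫ r in (0 : ℝ)..t, memProp ω₂ lam β γ T N r z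

/-- The RETURN DEFICIT `R_N(t) = ‖p₀ + ∂_{p₀} u_t‖²_{L²(μ_T)}` (`0` on the empty chain). -/
def returnDeficit (ω₂ lam β γ T : ℝ) (N : ℕ) (t : ℝ) : ℝ :=
  if h : 0 < N then
    ∫ z, (z.2 ⟨0, h⟩ + partialP ⟨0, h⟩ (heatPotential ω₂ lam β γ T N t) z) ^ 2
      ∂((pinnedChain ω₂ lam β γ).gibbsMeasure N T)
  else 0

/-- The LEAK `L_N(t) = ‖∂_{p_{N−1}} u_t‖²_{L²(μ_T)}` (`0` on the empty chain). -/
def leak (ω₂ lam β γ T : ℝ) (N : ℕ) (t : ℝ) : ℝ :=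
  if h : 0 < N then
    ∫ z, (partialP ⟨N - 1, Nat.sub_lt h Nat.one_pos⟩ (heatPotential ω₂ lam β γ T N t) z) ^ 2
      ∂((pinnedChain ω₂ lam β γ).gibbsMeasure N T)
  else 0

/-- The boundary kernel `K_N(u) = ⟨θ₀, P_u θ₀⟩_{μ_T}` — VERBATIM the `let K` of route
`BoundaryEscapeDeficit` (items 12235–12241) and of card A. -/
def memKernel (ω₂ lam β γ T : ℝ) (N : ℕ) (u : ℝ) : ℝ :=
  if h : 0 < N then
    ∫ z, ((z.2 ⟨0, h⟩) ^ 2 - T) *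
        (∫ y, ((y.2 ⟨0, h⟩) ^ 2 - T) ∂((pinnedChain ω₂ lam β γ).transitionKernel N T T u.toNNReal z))
      ∂((pinnedChain ω₂ lam β γ).gibbsMeasure N T)
  else 0

/-- The ESCAPE-DEFICIT CURVE `1 − θ_N(t)`, `θ_N(t) = (γ/T²) ∫₀ᵗ K_N(u) du` (the `let θ` of
`BoundaryEscapeDeficit`). -/
def deficit (ω₂ lam β γ T : ℝ) (N : ℕ) (t : ℝ) : ℝ :=
  1 - γ / T ^ 2 * ∫ u in (0 : ℝ)..t, memKernel ω₂ lam β γ T N u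

/-- `C_N(b,s)` — VERBATIM the `let C` of the crux `SubdiffusiveBondHeat`. -/
def bondCorr (ω₂ lam β γ T : ℝ) (N b : ℕ) (s : ℝ) : ℝ :=
  if h : b < N then
    ∫ z, (pinnedChain ω₂ lam β γ).bondCurrent N ⟨b, h⟩ z *
        (∫ y, (pinnedChain ω₂ lam β γ).bondCurrent N ⟨b, h⟩ y
          ∂((pinnedChain ω₂ lam β γ).transitionKernel N T T s.toNNReal z))
      ∂((pinnedChain ω₂ lam β γ).gibbsMeasure N T)
  else 0

/-- `V_N(b,t) = 2∫₀ᵗ (t − s) C_N(b,s) ds` — VERBATIM the `let V` of the crux `SubdiffusiveBondHeat`. -/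
def bondHeatVar (ω₂ lam β γ T : ℝ) (N b : ℕ) (t : ℝ) : ℝ :=
  2 * ∫ s in (0 : ℝ)..t, (t - s) * bondCorr ω₂ lam β γ T N b s

/-- The site-0 energy `e₀ = p₀²/2 + U(q₀) + ½ V(q₁ − q₀)` (`0` if `N ≤ 1`); with the tree's symmetric bond
current, `L_H e₀ = −j₀` and `L e₀ = −j₀ − γ θ₀`, so that pathwise `∫₀ᵗ j₀ = Q^L_t − Δe₀`. -/
def siteZeroEnergy (ω₂ lam β γ : ℝ) (N : ℕ) (z : PhaseSpace N) : ℝ :=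
  if h : 1 < N then
    (z.2 ⟨0, Nat.zero_lt_of_lt h⟩) ^ 2 / 2 + (pinnedChain ω₂ lam β γ).U (z.1 ⟨0, Nat.zero_lt_of_lt h⟩) +
      (pinnedChain ω₂ lam β γ).V (z.1 ⟨1, h⟩ - z.1 ⟨0, Nat.zero_lt_of_lt h⟩) / 2
  else 0

/-- `Var_{μ_T^N}(e₀)`. -/
def siteZeroEnergyVar (ω₂ lam β γ T : ℝ) (N : ℕ) : ℝ :=
  ∫ z, (siteZeroEnergy ω₂ lam β γ N z -
      ∫ y, siteZeroEnergy ω₂ lam β γ N y ∂((pinnedChain ω₂ lam β γ).gibbsMeasure N T)) ^ 2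
    ∂((pinnedChain ω₂ lam β γ).gibbsMeasure N T)

/-! ## Statements of the stubs -/

/-- **C⁺₁ — boundary memory decay (dyadic form).** `∃ C, c > 0, N₀: ∀ N ≥ N₀, ∀ k` with
`2^k ≤ cN²`: `m_N(2^k)² ≤ C·(2^k)^{−3/2}`.  Reading: `s` seconds after a Gibbs start, two replicas with
independent bath noises have contact temperatures correlated only at the hydrodynamic level
`‖P_sθ₀‖² ≍ χ s^{−3/2}` (boundary-flux kernel of a diffusive rod with Robin contact), down to the Thouless
time where the total-energy floor `s^{−1/2}N^{−1/2}` is met.  FALSE for the harmonic member on `[1, N]`. -/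
def BoundaryMemoryDecay : Prop :=
  ∀ ω₂ lam β γ : ℝ, 0 < ω₂ → 0 < lam → 0 < β → 0 < γ → ∀ T : ℝ, 0 < T →
    ∃ C c : ℝ, 0 < c ∧ ∃ N₀ : ℕ, ∀ N : ℕ, N₀ ≤ N → ∀ k : ℕ, (2 : ℝ) ^ k ≤ c * (N : ℝ) ^ 2 →
      memNormSq ω₂ lam β γ T N ((2 : ℝ) ^ k) ≤ C / ((2 : ℝ) ^ k) ^ (3 / 2 : ℝ)

/-- **C⁺₂ — return-deficit decay.** `∃ C, c > 0, N₀: ∀ N ≥ N₀, ∀ s ∈ [1, cN²]`: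
`‖p₀ + ∂_{p₀}u_s‖²_{L²(μ_T)} ≤ C/√s` (an N-uniform Bismut–Elworthy–Li-type bound: the sensitivity of the
expected injected heat to a kick of the SAME bath cancels `p₀` up to the not-yet-reabsorbed part). -/
def ReturnDeficitDecay : Prop :=
  ∀ ω₂ lam β γ : ℝ, 0 < ω₂ → 0 < lam → 0 < β → 0 < γ → ∀ T : ℝ, 0 < T →
    ∃ C c : ℝ, 0 < c ∧ ∃ N₀ : ℕ, ∀ N : ℕ, N₀ ≤ N → ∀ s : ℝ, 1 ≤ s → s ≤ c * (N : ℝ) ^ 2 →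
      returnDeficit ω₂ lam β γ T N s ≤ C / Real.sqrt s

/-- **C⁺₃ — leak decay.** `∃ C, c > 0, N₀: ∀ N ≥ N₀, ∀ s ∈ [1, cN²]`: `‖∂_{p_{N−1}}u_s‖² ≤ C/√s`
(sensitivity of the expected injected heat at the LEFT bath to a kick of the FAR bath; physically
exponentially small before the Thouless time). -/
def LeakDecay : Prop :=
  ∀ ω₂ lam β γ : ℝ, 0 < ω₂ → 0 < lam → 0 < β → 0 < γ → ∀ T : ℝ, 0 < T →
    ∃ C c : ℝ, 0 < c ∧ ∃ N₀ : ℕ, ∀ N : ℕ, N₀ ≤ N → ∀ s : ℝ, 1 ≤ s → s ≤ c * (N : ℝ) ^ 2 →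
      leak ω₂ lam β γ T N s ≤ C / Real.sqrt s

/-- **Fixed-N contact semigroup calculus** (every `N ≥ 2`, both baths at `T`):
(a) the martingale/dissipation bound — the exact identity
  (T′) `1 − θ_N(t) = (γ/T²) ∫₀ᵗ ⟨P_rθ₀, P_tθ₀⟩_{μ_T} dr + (R_N(t) + L_N(t))/T`
after Cauchy–Schwarz `⟨P_rθ₀, P_tθ₀⟩ ≤ m_N(r) m_N(t)`.  Derivation of (T′) without path space: with
`u_t = −γ∫₀ᵗP_rθ₀`, `L u_t = −γ(P_tθ₀ − θ₀)`, `⟨u, Lu⟩_{μ_T} = −γT Σ_{i∈{0,N−1}} ‖∂_{p_i}u‖²` and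
`⟨θ₀, u_t⟩ = −T²θ_N(t)`, (T′) is equivalent to `θ_N(t) = −⟨p₀, ∂_{p₀}u_t⟩_{μ_T}/T`, i.e. to Gaussian
integration by parts `⟨p₀, ∂_{p₀}f⟩_{μ_T} = ⟨f, θ₀⟩_{μ_T}/T` (probabilistically: Clark–Ocone for `Q^L_t`,
`dN_τ = √(2γT)[(p₀+∂_{p₀}u_{t−τ})dW^L + ∂_{p_{N−1}}u_{t−τ} dW^R]`, differentiated in `t`);
(b) `L²(μ_T)`-contraction of the constructed semigroup along one orbit: `s ↦ m_N(s)²` is non-increasing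
(`d/ds m² = −2γT Σ‖∂_{p_i}P_sθ₀‖² ≤ 0`; needs Gibbs invariance of the constructed kernels);
(c) `m_N(0)² ≤ ‖θ₀‖² = Var_{μ_T}(p₀²) = 2T²`; (d) `|K_N(u)| ≤ 2T²`.
Real content: hypoelliptic regularity of `u_t` (in tree at fixed N: `LangevinChainHormander`,
`LangevinChainKernelDensity`), growth control for the integrations by parts against `e^{−H/T}`, kernel
invariance of `gibbsMeasure` (Dynkin + forward uniqueness). -/
def ContactSemigroupCalculus : Prop :=
  ∀ ω₂ lam β γ : ℝ, 0 < ω₂ → 0 < lam → 0 < β → 0 < γ → ∀ T : ℝ, 0 < T → ∀ N : ℕ, 2 ≤ N →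
    (∀ t : ℝ, 0 ≤ t →
      deficit ω₂ lam β γ T N t ≤
        γ / T ^ 2 * (∫ r in (0 : ℝ)..t,
            Real.sqrt (memNormSq ω₂ lam β γ T N r) * Real.sqrt (memNormSq ω₂ lam β γ T N t)) +
          (returnDeficit ω₂ lam β γ T N t + leak ω₂ lam β γ T N t) / T) ∧
    (∀ r s : ℝ, 0 ≤ r → r ≤ s → memNormSq ω₂ lam β γ T N s ≤ memNormSq ω₂ lam β γ T N r) ∧
    memNormSq ω₂ lam β γ T N 0 ≤ 2 * T ^ 2 ∧
    (∀ u : ℝ, 0 ≤ u → |memKernel ω₂ lam β γ T N u| ≤ 2 * T ^ 2)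

/-- **Bath-heat/deficit formula** (card A, fixed `N ≥ 2`, `t ≥ 0`):
`V_N(0,t) ≤ 4γT² ∫₀ᵗ (1 − θ_N(s)) ds + 8 Var_{μ_T}(e₀)`.  From the pathwise energy balance
`∫₀ᵗ j₀ = Q^L_t − Δe₀` (so `Var ∫₀ᵗj₀ ≤ 2Var Q^L_t + 2Var Δe₀ ≤ 2Var Q^L_t + 8Var e₀`), the identities
`Var_eq(∫₀ᵗ j₀) = V_N(0,t)` (stationarity + Markov) and `Var_eq(Q^L_t) = 2γT²t − 2γ²∫₀ᵗ(t−u)K_N(u)du =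
2γT² ∫₀ᵗ(1−θ_N)` (Itô for `(Q^L)²`, `Q^L_t = −γ∫₀ᵗθ₀ + M_t`, `E M_t² = 2γT²t`, and Θ-reversibility of the
equilibrium kernel process for `E[θ₀(s)M_s] = 2γ∫₀ˢK_N`).  Slopes: `2γT²` at `0⁺`, `2γT²E_N = 2T²G_N` at `∞`
(Kundu–Dhar–Narayan saturation). -/
def BathHeatDeficitFormula : Prop :=
  ∀ ω₂ lam β γ : ℝ, 0 < ω₂ → 0 < lam → 0 < β → 0 < γ → ∀ T : ℝ, 0 < T → ∀ N : ℕ, 2 ≤ N →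
    ∀ t : ℝ, 0 ≤ t →
      bondHeatVar ω₂ lam β γ T N 0 t ≤
        4 * γ * T ^ 2 * (∫ s in (0 : ℝ)..t, deficit ω₂ lam β γ T N s) +
          8 * siteZeroEnergyVar ω₂ lam β γ T N

/-- **Local energy statics**: `Var_{μ_T^N}(e₀)` is bounded uniformly in `N ≥ 2` (one-dimensional Gibbs
measure with nearest-neighbour coupling: uniform moments of `U(q₀)`, `V(q₁ − q₀)`; `p₀ ~ N(0,T)`). -/
def LocalEnergyVariance : Prop :=
  ∀ ω₂ lam β γ : ℝ, 0 < ω₂ → 0 < lam → 0 < β → 0 < γ → ∀ T : ℝ, 0 < T →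
    ∃ σ2 : ℝ, ∀ N : ℕ, 2 ≤ N → siteZeroEnergyVar ω₂ lam β γ T N ≤ σ2

/-! ## Intermediate statements (not stubs) -/

/-- **DeficitUpperTail** — card A's `C⁺`, the hinge of the joint line: `∃ C, c > 0, N₀: ∀ N ≥ N₀,
∀ s ∈ [1, cN²]`, `1 − θ_N(s) ≤ C/√s`.  PROVED below from the triad (`deficitUpperTail_of_triad`); card A's
own engine (Abel form + SUP variational principle) is an alternative supplier of the same statement. -/
def DeficitUpperTail : Prop :=
  ∀ ω₂ lam β γ : ℝ, 0 < ω₂ → 0 < lam → 0 < β → 0 < γ → ∀ T : ℝ, 0 < T →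
    ∃ C c : ℝ, 0 < c ∧ ∃ N₀ : ℕ, ∀ N : ℕ, N₀ ≤ N → ∀ s : ℝ, 1 ≤ s → s ≤ c * (N : ℝ) ^ 2 →
      deficit ω₂ lam β γ T N s ≤ C / Real.sqrt s

/-- **(S) at the bath bond** `b = 0`, with the crux's own `V_N` (`bondHeatVar`). -/
def BathBondEW : Prop :=
  ∀ ω₂ lam β γ : ℝ, 0 < ω₂ → 0 < lam → 0 < β → 0 < γ → ∀ T : ℝ, 0 < T →
    ∃ A c : ℝ, 0 < c ∧ ∃ N₀ : ℕ, ∀ N : ℕ, N₀ ≤ N →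
      0 + 1 < N ∧ ∀ t : ℝ, 1 ≤ t → t ≤ c * (N : ℝ) ^ 2 →
        bondHeatVar ω₂ lam β γ T N 0 t ≤ A * Real.sqrt t

/-! ## Registered stubs -/

/-- STUB 1 (size XL, the HARDEST; N-uniform): boundary memory decay C⁺₁ along dyadic times. -/
theorem stub_boundaryMemoryDecay : BoundaryMemoryDecay := by
  sorry

/-- STUB 2 (size L–XL; N-uniform): return-deficit decay C⁺₂. -/
theorem stub_returnDeficitDecay : ReturnDeficitDecay := by
  sorry

/-- STUB 3 (size L; N-uniform): leak decay C⁺₃. -/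
theorem stub_leakDecay : LeakDecay := by
  sorry

/-- STUB 4 (size L; fixed N): the martingale/dissipation bound (T′) and the `L²(μ_T)`-contraction facts of
the constructed equilibrium semigroup at the contact. -/
theorem stub_contactSemigroupCalculus : ContactSemigroupCalculus := by
  sorry

/-- STUB 5 (size L; fixed N): card A's bath-heat/deficit formula `V_N(0,t) ≤ 4γT²∫₀ᵗ(1−θ_N) + 8Var e₀`. -/
theorem stub_bathHeatDeficitFormula : BathHeatDeficitFormula := by
  sorry

/-- STUB 6 (size M; static, N-uniform): `sup_N Var_{μ_T^N}(e₀) < ∞`. -/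
theorem stub_localEnergyVariance : LocalEnergyVariance := by
  sorry

/-! ## Composition (sorry-free) -/

/-- Dyadic-to-pointwise for a non-increasing function: `f(2^k) ≤ C (2^k)^{−3/2}` for `2^k ≤ L` gives
`f(s) ≤ 2^{3/2}|C| s^{−3/2}` for `1 ≤ s ≤ L`. -/
theorem dyadic_to_pointwise {f : ℝ → ℝ} {C L : ℝ}
    (hmono : ∀ r s : ℝ, 0 ≤ r → r ≤ s → f s ≤ f r)
    (hdy : ∀ k : ℕ, (2 : ℝ) ^ k ≤ L → f ((2 : ℝ) ^ k) ≤ C / ((2 : ℝ) ^ k) ^ (3 / 2 : ℝ))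
    {s : ℝ} (hs1 : 1 ≤ s) (hsL : s ≤ L) :
    f s ≤ 2 ^ (3 / 2 : ℝ) * |C| / s ^ (3 / 2 : ℝ) := by
  obtain ⟨n, hn, hn'⟩ := exists_nat_pow_near hs1 one_lt_two
  have h2n : (0 : ℝ) < 2 ^ n := pow_pos two_pos n
  have hs0 : 0 < s := by linarith
  have hs2 : s / 2 ≤ 2 ^ n := by rw [pow_succ] at hn'; linarith
  have hden : 0 < ((2 : ℝ) ^ n) ^ (3 / 2 : ℝ) := Real.rpow_pos_of_pos h2n _
  calc f s ≤ f (2 ^ n) := hmono _ _ h2n.le hn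
    _ ≤ C / ((2 : ℝ) ^ n) ^ (3 / 2 : ℝ) := hdy n (hn.trans hsL)
    _ ≤ |C| / ((2 : ℝ) ^ n) ^ (3 / 2 : ℝ) := div_le_div_of_nonneg_right (le_abs_self C) hden.le
    _ ≤ |C| / (s / 2) ^ (3 / 2 : ℝ) := by
        apply div_le_div_of_nonneg_left (abs_nonneg C) (Real.rpow_pos_of_pos (by linarith) _)
        exact Real.rpow_le_rpow (by linarith) hs2 (by norm_num)
    _ = 2 ^ (3 / 2 : ℝ) * |C| / s ^ (3 / 2 : ℝ) := by
        rw [Real.div_rpow hs0.le zero_le_two, div_div_eq_mul_div]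
        ring

/-- `m ≤ B s^{−3/2}` gives `√m ≤ √B · s^{−3/4}`. -/
theorem sqrt_bound {m B s : ℝ} (hs : 0 < s) (hB : 0 ≤ B) (h : m ≤ B / s ^ (3 / 2 : ℝ)) :
    Real.sqrt m ≤ Real.sqrt B * s ^ (-(3 / 4 : ℝ)) := by
  have h1 : Real.sqrt m ≤ Real.sqrt (B / s ^ (3 / 2 : ℝ)) := Real.sqrt_le_sqrt h
  rw [Real.sqrt_div hB, Real.sqrt_eq_rpow (s ^ (3 / 2 : ℝ)), ← Real.rpow_mul hs.le,
    show (3 / 2 : ℝ) * (1 / 2) = 3 / 4 by norm_num] at h1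
  rw [Real.rpow_neg hs.le, ← div_eq_mul_inv]
  exact h1

/-- **The Minkowski step, abstractly**: if `0 ≤ M ≤ A` on `[0, ∞)` and `M(r) ≤ B r^{−3/4}` on `[1, s]`
then `∫₀ˢ M(r) M(s) dr ≤ (AB + 4B²) s^{−1/2}` (`s ≥ 1`). -/
theorem memory_integral_bound {M : ℝ → ℝ} {A B s : ℝ} (hs : 1 ≤ s) (hA : 0 ≤ A) (hB : 0 ≤ B)
    (hM0 : ∀ r : ℝ, 0 ≤ r → 0 ≤ M r)
    (hMA : ∀ r : ℝ, 0 ≤ r → M r ≤ A)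
    (hMB : ∀ r : ℝ, 1 ≤ r → r ≤ s → M r ≤ B * r ^ (-(3 / 4 : ℝ))) :
    (∫ r in (0 : ℝ)..s, M r * M s) ≤ (A * B + 4 * B ^ 2) * s ^ (-(1 / 2 : ℝ)) := by
  have hs0 : 0 < s := by linarith
  have hMs : M s ≤ B * s ^ (-(3 / 4 : ℝ)) := hMB s hs le_rfl
  have hMs0 : 0 ≤ M s := hM0 s hs0.le
  have hAB : 0 ≤ A * B := mul_nonneg hA hB
  have hR : 0 ≤ (A * B + 4 * B ^ 2) * s ^ (-(1 / 2 : ℝ)) :=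
    mul_nonneg (add_nonneg hAB (by positivity)) (Real.rpow_nonneg hs0.le _)
  by_cases hint : IntervalIntegrable (fun r => M r * M s) volume 0 s
  · have h01 : IntervalIntegrable (fun r => M r * M s) volume 0 1 :=
      hint.mono_set (Set.uIcc_subset_uIcc_left (Set.mem_uIcc_of_le zero_le_one hs))
    have h1s : IntervalIntegrable (fun r => M r * M s) volume 1 s :=
      hint.mono_set (Set.uIcc_subset_uIcc_right (Set.mem_uIcc_of_le zero_le_one hs))
    rw [← intervalIntegral.integral_add_adjacent_intervals h01 h1s]
    have hp1 : (∫ r in (0 : ℝ)..1, M r * M s) ≤ ∫ _ in (0 : ℝ)..1, A * M s :=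
      intervalIntegral.integral_mono_on zero_le_one h01 intervalIntegrable_const
        (fun r hr => mul_le_mul_of_nonneg_right (hMA r hr.1) hMs0)
    have hp1' : (∫ _ in (0 : ℝ)..1, A * M s) = A * M s := by simp
    have hp2 : (∫ r in (1 : ℝ)..s, M r * M s) ≤ ∫ r in (1 : ℝ)..s, B * r ^ (-(3 / 4 : ℝ)) * M s :=
      intervalIntegral.integral_mono_on hs h1s
        (((intervalIntegral.intervalIntegrable_rpow' (by norm_num)).const_mul B).mul_const (M s))
        (fun r hr => mul_le_mul_of_nonneg_right (hMB r hr.1 hr.2) hMs0)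
    have hp2' : (∫ r in (1 : ℝ)..s, B * r ^ (-(3 / 4 : ℝ)) * M s) =
        B * M s * (4 * (s ^ (1 / 4 : ℝ) - 1)) := by
      have : (∫ r in (1 : ℝ)..s, B * r ^ (-(3 / 4 : ℝ)) * M s) =
          B * M s * ∫ r in (1 : ℝ)..s, r ^ (-(3 / 4 : ℝ)) := by
        rw [← intervalIntegral.integral_const_mul]
        congr 1
        funext r
        ring
      rw [this, integral_rpow (Or.inl (by norm_num)), show (-(3 / 4 : ℝ)) + 1 = 1 / 4 by norm_num,
        Real.one_rpow]
      ring
    have h14 : 0 ≤ s ^ (1 / 4 : ℝ) := Real.rpow_nonneg hs0.le _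
    have h34 : 0 ≤ s ^ (-(3 / 4 : ℝ)) := Real.rpow_nonneg hs0.le _
    have e1 : A * M s ≤ A * (B * s ^ (-(3 / 4 : ℝ))) := mul_le_mul_of_nonneg_left hMs hA
    have e2 : B * M s * (4 * (s ^ (1 / 4 : ℝ) - 1)) ≤ B * M s * (4 * s ^ (1 / 4 : ℝ)) :=
      mul_le_mul_of_nonneg_left (by linarith) (mul_nonneg hB hMs0)
    have e3 : B * M s * (4 * s ^ (1 / 4 : ℝ)) ≤ B * (B * s ^ (-(3 / 4 : ℝ))) * (4 * s ^ (1 / 4 : ℝ)) :=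
      mul_le_mul_of_nonneg_right (mul_le_mul_of_nonneg_left hMs hB) (by positivity)
    have hpow : s ^ (-(3 / 4 : ℝ)) * s ^ (1 / 4 : ℝ) = s ^ (-(1 / 2 : ℝ)) := by
      rw [← Real.rpow_add hs0]
      norm_num
    have hexp : s ^ (-(3 / 4 : ℝ)) ≤ s ^ (-(1 / 2 : ℝ)) :=
      Real.rpow_le_rpow_of_exponent_le hs (by norm_num)
    calc (∫ r in (0 : ℝ)..1, M r * M s) + ∫ r in (1 : ℝ)..s, M r * M s
        ≤ (∫ _ in (0 : ℝ)..1, A * M s) + ∫ r in (1 : ℝ)..s, B * r ^ (-(3 / 4 : ℝ)) * M s :=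
          add_le_add hp1 hp2
      _ = A * M s + B * M s * (4 * (s ^ (1 / 4 : ℝ) - 1)) := by rw [hp1', hp2']
      _ ≤ A * (B * s ^ (-(3 / 4 : ℝ))) + B * (B * s ^ (-(3 / 4 : ℝ))) * (4 * s ^ (1 / 4 : ℝ)) := by
          linarith
      _ = A * B * s ^ (-(3 / 4 : ℝ)) + 4 * B ^ 2 * (s ^ (-(3 / 4 : ℝ)) * s ^ (1 / 4 : ℝ)) := by ring
      _ = A * B * s ^ (-(3 / 4 : ℝ)) + 4 * B ^ 2 * s ^ (-(1 / 2 : ℝ)) := by rw [hpow]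
      _ ≤ A * B * s ^ (-(1 / 2 : ℝ)) + 4 * B ^ 2 * s ^ (-(1 / 2 : ℝ)) :=
          add_le_add (mul_le_mul_of_nonneg_left hexp hAB) le_rfl
      _ = (A * B + 4 * B ^ 2) * s ^ (-(1 / 2 : ℝ)) := by ring
  · rw [intervalIntegral.integral_undef hint]
    exact hR

/-- Integrating the deficit curve: a bound `K` on `[0, 1]` and `C/√s` on `[1, t]` give
`∫₀ᵗ D ≤ K + 2C√t` (`t ≥ 1`, `K, C ≥ 0`). -/
theorem deficit_integral_bound {D : ℝ → ℝ} {K C t : ℝ} (ht : 1 ≤ t) (hK : 0 ≤ K) (hC : 0 ≤ C)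
    (hD1 : ∀ s : ℝ, 0 ≤ s → s ≤ 1 → D s ≤ K)
    (hD2 : ∀ s : ℝ, 1 ≤ s → s ≤ t → D s ≤ C / Real.sqrt s) :
    (∫ s in (0 : ℝ)..t, D s) ≤ K + 2 * C * Real.sqrt t := by
  have ht0 : 0 < t := by linarith
  have hR : 0 ≤ K + 2 * C * Real.sqrt t :=
    add_nonneg hK (mul_nonneg (mul_nonneg zero_le_two hC) (Real.sqrt_nonneg t))
  by_cases hint : IntervalIntegrable D volume 0 t
  · have h01 : IntervalIntegrable D volume 0 1 :=
      hint.mono_set (Set.uIcc_subset_uIcc_left (Set.mem_uIcc_of_le zero_le_one ht))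
    have h1t : IntervalIntegrable D volume 1 t :=
      hint.mono_set (Set.uIcc_subset_uIcc_right (Set.mem_uIcc_of_le zero_le_one ht))
    rw [← intervalIntegral.integral_add_adjacent_intervals h01 h1t]
    have hp1 : (∫ s in (0 : ℝ)..1, D s) ≤ ∫ _ in (0 : ℝ)..1, K :=
      intervalIntegral.integral_mono_on zero_le_one h01 intervalIntegrable_const
        (fun s hs => hD1 s hs.1 hs.2)
    have hp1' : (∫ _ in (0 : ℝ)..1, K) = K := by simp
    have hp2 : (∫ s in (1 : ℝ)..t, D s) ≤ ∫ s in (1 : ℝ)..t, C * s ^ (-(1 / 2 : ℝ)) := by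
      refine intervalIntegral.integral_mono_on ht h1t
        ((intervalIntegral.intervalIntegrable_rpow' (by norm_num)).const_mul C) ?_
      intro s hs
      have hs0 : 0 < s := by linarith [hs.1]
      calc D s ≤ C / Real.sqrt s := hD2 s hs.1 hs.2
        _ = C * s ^ (-(1 / 2 : ℝ)) := by
            rw [Real.sqrt_eq_rpow, Real.rpow_neg hs0.le, div_eq_mul_inv]
    have hp2' : (∫ s in (1 : ℝ)..t, C * s ^ (-(1 / 2 : ℝ))) = C * (2 * (Real.sqrt t - 1)) := by
      rw [intervalIntegral.integral_const_mul, integral_rpow (Or.inl (by norm_num)),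
        show (-(1 / 2 : ℝ)) + 1 = 1 / 2 by norm_num, Real.one_rpow, ← Real.sqrt_eq_rpow]
      ring
    calc (∫ s in (0 : ℝ)..1, D s) + ∫ s in (1 : ℝ)..t, D s
        ≤ (∫ _ in (0 : ℝ)..1, K) + ∫ s in (1 : ℝ)..t, C * s ^ (-(1 / 2 : ℝ)) := add_le_add hp1 hp2
      _ = K + C * (2 * (Real.sqrt t - 1)) := by rw [hp1', hp2']
      _ ≤ K + 2 * C * Real.sqrt t := by nlinarith [Real.sqrt_nonneg t]
  · rw [intervalIntegral.integral_undef hint]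
    exact hR

/-- **Card C's shape, PROVED**: (T′) + C⁺₁ + C⁺₂ + C⁺₃ ⇒ `DeficitUpperTail`, with
`C′ = (γ/T²)(√2·T·√B + 4B) + (|C₂| + |C₃|)/T`, `B = 2^{3/2}|C₁|`, `c = min cᵢ`, `N₀ = max(2, Nᵢ)`. -/
theorem deficitUpperTail_of_triad (h4 : ContactSemigroupCalculus) (h1 : BoundaryMemoryDecay)
    (h2 : ReturnDeficitDecay) (h3 : LeakDecay) : DeficitUpperTail := by
  intro ω₂ lam β γ hω hl hβ hγ T hT
  obtain ⟨C₁, c₁, hc₁, N₁, hN₁⟩ := h1 ω₂ lam β γ hω hl hβ hγ T hT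
  obtain ⟨C₂, c₂, hc₂, N₂, hN₂⟩ := h2 ω₂ lam β γ hω hl hβ hγ T hT
  obtain ⟨C₃, c₃, hc₃, N₃, hN₃⟩ := h3 ω₂ lam β γ hω hl hβ hγ T hT
  have hcalc := h4 ω₂ lam β γ hω hl hβ hγ T hT
  set B : ℝ := (2 : ℝ) ^ (3 / 2 : ℝ) * |C₁| with hB
  have hB0 : 0 ≤ B := by positivity
  refine ⟨γ / T ^ 2 * (Real.sqrt 2 * T * Real.sqrt B + 4 * B) + (|C₂| + |C₃|) / T,
    min c₁ (min c₂ c₃), lt_min hc₁ (lt_min hc₂ hc₃), max 2 (max N₁ (max N₂ N₃)), ?_⟩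
  intro N hN s hs1 hsc
  have hN2 : 2 ≤ N := by omega
  have hNN₁ : N₁ ≤ N := by omega
  have hNN₂ : N₂ ≤ N := by omega
  have hNN₃ : N₃ ≤ N := by omega
  have hs0 : 0 < s := by linarith
  have hN2pos : (0 : ℝ) ≤ (N : ℝ) ^ 2 := by positivity
  have hs₁ : s ≤ c₁ * (N : ℝ) ^ 2 := hsc.trans (mul_le_mul_of_nonneg_right (min_le_left _ _) hN2pos)
  have hs₂ : s ≤ c₂ * (N : ℝ) ^ 2 :=
    hsc.trans (mul_le_mul_of_nonneg_right ((min_le_right _ _).trans (min_le_left _ _)) hN2pos)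
  have hs₃ : s ≤ c₃ * (N : ℝ) ^ 2 :=
    hsc.trans (mul_le_mul_of_nonneg_right ((min_le_right _ _).trans (min_le_right _ _)) hN2pos)
  obtain ⟨hTb, hmono, hm0, -⟩ := hcalc N hN2
  -- pointwise memory bound on [1, s] from the dyadic one + monotonicity
  have hpt : ∀ r : ℝ, 1 ≤ r → r ≤ s → memNormSq ω₂ lam β γ T N r ≤ B / r ^ (3 / 2 : ℝ) := by
    intro r hr1 hrs
    have := dyadic_to_pointwise (f := memNormSq ω₂ lam β γ T N) (C := C₁) (L := c₁ * (N : ℝ) ^ 2)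
      hmono (fun k hk => hN₁ N hNN₁ k hk) hr1 (hrs.trans hs₁)
    simpa [hB] using this
  -- the three hypotheses of the abstract Minkowski step
  have hM0 : ∀ r : ℝ, 0 ≤ r → 0 ≤ Real.sqrt (memNormSq ω₂ lam β γ T N r) :=
    fun r _ => Real.sqrt_nonneg _
  have hMA : ∀ r : ℝ, 0 ≤ r → Real.sqrt (memNormSq ω₂ lam β γ T N r) ≤ Real.sqrt 2 * T := by
    intro r hr
    have h := (hmono 0 r le_rfl hr).trans hm0
    calc Real.sqrt (memNormSq ω₂ lam β γ T N r) ≤ Real.sqrt (2 * T ^ 2) := Real.sqrt_le_sqrt h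
      _ = Real.sqrt 2 * T := by rw [Real.sqrt_mul zero_le_two, Real.sqrt_sq hT.le]
  have hMB : ∀ r : ℝ, 1 ≤ r → r ≤ s →
      Real.sqrt (memNormSq ω₂ lam β γ T N r) ≤ Real.sqrt B * r ^ (-(3 / 4 : ℝ)) :=
    fun r hr1 hrs => sqrt_bound (by linarith) hB0 (hpt r hr1 hrs)
  have hsq : s ^ (-(1 / 2 : ℝ)) = 1 / Real.sqrt s := by
    rw [Real.sqrt_eq_rpow, Real.rpow_neg hs0.le, inv_eq_one_div]
  have hsqpos : 0 < Real.sqrt s := Real.sqrt_pos.mpr hs0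
  have hI : (∫ r in (0 : ℝ)..s,
      Real.sqrt (memNormSq ω₂ lam β γ T N r) * Real.sqrt (memNormSq ω₂ lam β γ T N s)) ≤
      (Real.sqrt 2 * T * Real.sqrt B + 4 * B) * (1 / Real.sqrt s) := by
    have := memory_integral_bound (M := fun r => Real.sqrt (memNormSq ω₂ lam β γ T N r)) hs1
      (by positivity) (Real.sqrt_nonneg B) hM0 hMA hMB
    rwa [Real.sq_sqrt hB0, hsq] at this
  have hR : returnDeficit ω₂ lam β γ T N s ≤ |C₂| / Real.sqrt s :=
    (hN₂ N hNN₂ s hs1 hs₂).trans (div_le_div_of_nonneg_right (le_abs_self _) hsqpos.le)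
  have hL : leak ω₂ lam β γ T N s ≤ |C₃| / Real.sqrt s :=
    (hN₃ N hNN₃ s hs1 hs₃).trans (div_le_div_of_nonneg_right (le_abs_self _) hsqpos.le)
  have hγT : 0 ≤ γ / T ^ 2 := div_nonneg hγ.le (by positivity)
  calc deficit ω₂ lam β γ T N s
      ≤ γ / T ^ 2 * (∫ r in (0 : ℝ)..s,
            Real.sqrt (memNormSq ω₂ lam β γ T N r) * Real.sqrt (memNormSq ω₂ lam β γ T N s)) +
          (returnDeficit ω₂ lam β γ T N s + leak ω₂ lam β γ T N s) / T := hTb s hs0.le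
    _ ≤ γ / T ^ 2 * ((Real.sqrt 2 * T * Real.sqrt B + 4 * B) * (1 / Real.sqrt s)) +
          (|C₂| / Real.sqrt s + |C₃| / Real.sqrt s) / T :=
        add_le_add (mul_le_mul_of_nonneg_left hI hγT)
          (div_le_div_of_nonneg_right (add_le_add hR hL) hT.le)
    _ = (γ / T ^ 2 * (Real.sqrt 2 * T * Real.sqrt B + 4 * B) + (|C₂| + |C₃|) / T) / Real.sqrt s := by
        field_simp

/-- **Card A's shape, PROVED**: the bath-heat/deficit formula, the local energy statics and
`DeficitUpperTail` give (S) at the bath bond, with `A = 4γT²(1 + 2γ + 2|C′|) + 8|σ²|`. The short-time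
piece `∫₀¹ (1 − θ_N) ≤ 1 + 2γ` uses `|K_N| ≤ 2T²` from the fixed-N calculus. -/
theorem bathBondEW_of_deficit (h4 : ContactSemigroupCalculus) (h5 : BathHeatDeficitFormula)
    (h6 : LocalEnergyVariance) (hD : DeficitUpperTail) : BathBondEW := by
  intro ω₂ lam β γ hω hl hβ hγ T hT
  obtain ⟨C, c, hc, N₁, hN₁⟩ := hD ω₂ lam β γ hω hl hβ hγ T hT
  obtain ⟨σ2, hσ⟩ := h6 ω₂ lam β γ hω hl hβ hγ T hT
  refine ⟨4 * γ * T ^ 2 * ((1 + 2 * γ) + 2 * |C|) + 8 * |σ2|, c, hc, max 2 N₁, ?_⟩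
  intro N hN
  have hN2 : 2 ≤ N := by omega
  have hNN₁ : N₁ ≤ N := by omega
  refine ⟨by omega, fun t ht htc => ?_⟩
  obtain ⟨-, -, -, hK⟩ := h4 ω₂ lam β γ hω hl hβ hγ T hT N hN2
  have ht0 : 0 < t := by linarith
  have hγT : 0 ≤ γ / T ^ 2 := div_nonneg hγ.le (by positivity)
  -- short times: 1 - θ_N(s) ≤ 1 + 2γ on [0, 1]
  have hshort : ∀ s : ℝ, 0 ≤ s → s ≤ 1 → deficit ω₂ lam β γ T N s ≤ 1 + 2 * γ := by
    intro s hs0 hs1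
    have hint : |∫ u in (0 : ℝ)..s, memKernel ω₂ lam β γ T N u| ≤ 2 * T ^ 2 * s := by
      have h := intervalIntegral.norm_integral_le_of_norm_le_const (a := (0 : ℝ)) (b := s)
        (C := 2 * T ^ 2) (f := fun u => memKernel ω₂ lam β γ T N u) (fun u hu => by
          rw [Set.uIoc_of_le hs0] at hu
          rw [Real.norm_eq_abs]
          exact hK u hu.1.le)
      rw [Real.norm_eq_abs, sub_zero, abs_of_nonneg hs0] at h
      exact h
    have h1 : -(∫ u in (0 : ℝ)..s, memKernel ω₂ lam β γ T N u) ≤ 2 * T ^ 2 * s :=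
      (neg_le_abs _).trans hint
    calc deficit ω₂ lam β γ T N s
        = 1 + γ / T ^ 2 * (-(∫ u in (0 : ℝ)..s, memKernel ω₂ lam β γ T N u)) := by
          unfold deficit; ring
      _ ≤ 1 + γ / T ^ 2 * (2 * T ^ 2 * s) := by
          have := mul_le_mul_of_nonneg_left h1 hγT
          linarith
      _ = 1 + 2 * γ * s := by field_simp
      _ ≤ 1 + 2 * γ := by nlinarith [hγ.le]
  -- long times: the upper tail
  have hlong : ∀ s : ℝ, 1 ≤ s → s ≤ t → deficit ω₂ lam β γ T N s ≤ |C| / Real.sqrt s := by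
    intro s hs1 hst
    exact (hN₁ N hNN₁ s hs1 (hst.trans htc)).trans
      (div_le_div_of_nonneg_right (le_abs_self C) (Real.sqrt_nonneg s))
  have hInt : (∫ s in (0 : ℝ)..t, deficit ω₂ lam β γ T N s) ≤ (1 + 2 * γ) + 2 * |C| * Real.sqrt t :=
    deficit_integral_bound (D := fun s => deficit ω₂ lam β γ T N s) ht (by linarith) (abs_nonneg C)
      hshort hlong
  have h5' := h5 ω₂ lam β γ hω hl hβ hγ T hT N hN2 t ht0.le
  have h4γ : 0 ≤ 4 * γ * T ^ 2 := mul_nonneg (mul_nonneg (by norm_num) hγ.le) (sq_nonneg T)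
  have hσ' : siteZeroEnergyVar ω₂ lam β γ T N ≤ |σ2| := (hσ N hN2).trans (le_abs_self _)
  have hX : 0 ≤ 4 * γ * T ^ 2 * (1 + 2 * γ) + 8 * |σ2| :=
    add_nonneg (mul_nonneg h4γ (by linarith)) (by positivity)
  have h1t : 1 ≤ Real.sqrt t := Real.one_le_sqrt.mpr ht
  have hXt := mul_le_mul_of_nonneg_left h1t hX
  calc bondHeatVar ω₂ lam β γ T N 0 t
      ≤ 4 * γ * T ^ 2 * (∫ s in (0 : ℝ)..t, deficit ω₂ lam β γ T N s) +
          8 * siteZeroEnergyVar ω₂ lam β γ T N := h5'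
    _ ≤ 4 * γ * T ^ 2 * ((1 + 2 * γ) + 2 * |C| * Real.sqrt t) + 8 * |σ2| := by
        have := mul_le_mul_of_nonneg_left hInt h4γ
        linarith
    _ ≤ (4 * γ * T ^ 2 * ((1 + 2 * γ) + 2 * |C|) + 8 * |σ2|) * Real.sqrt t := by
        nlinarith

/-- **The skeleton concludes the crux BY NAME.** `SubdiffusiveBondHeat` (route `BondHeatUncertainty`,
stmt-AtomisticToContinuum-9120) from the six registered stubs: take the bath bond `b := 0`. -/
theorem SubdiffusiveBondHeat_of : SubdiffusiveBondHeat := by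
  have hEW : BathBondEW :=
    bathBondEW_of_deficit stub_contactSemigroupCalculus stub_bathHeatDeficitFormula
      stub_localEnergyVariance
      (deficitUpperTail_of_triad stub_contactSemigroupCalculus stub_boundaryMemoryDecay
        stub_returnDeficitDecay stub_leakDecay)
  intro ω₂ lam β γ hω hl hβ hγ T hT
  obtain ⟨A, c, hc, N₀, hN₀⟩ := hEW ω₂ lam β γ hω hl hβ hγ T hT
  refine ⟨A, c, hc, N₀, fun N hN => ⟨0, (hN₀ N hN).1, fun t ht htc => ?_⟩⟩
  exact (hN₀ N hN).2 t ht htc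

end Summit.AtomisticToContinuum.FouriersLaw.Cruxes.SubdiffusiveBondHeat.ContactKolmogorovTriad
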